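import Summits.ResolutionOfSingularities.ResolutionOfSingularities.Theorems.CrossCutLaw3
import HarnessLib

/-!
# CrossCutCells — decomp-res node «CrossCut» (lens-2 g20), file 1/2 of `CrossCutCells`

Content VERBATIM from the decomp-res lens-2 g20 node `HOME/decomp-res-lens-2/g20/CrossCut.lean` (pin 9ac8d1ca, 4 409
l; HOME = run/shared/lean/pub/decomp-res);
CRITIC-LEDGER row 160 (+1); landing orders INBOX :600 (and lens INBOX :582): l. 112–3564 are `SpreadCut` b2959d31
VERBATIM (landed as `SpreadCutLaw…` · `SpreadCutCells` ·
`MaxContactCutSpreadCut`) and are DELETED here with the landed modules imported instead (namespaces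
`…Theorems.PinchCut` / `JetCut` / `PurityCut` / `SplitCut` / `CylinderCut` /
`SpreadCut` opened; same short names, byte-identical bodies — never two copies); NEW = §X (l. 3566–4407).  Namespace
`…Theorems.CrossCut` (the lens's `Theses.CrossCut` is
gate-reserved), sub-namespaces `Cross` / `Leaf` as in the lens (inside the re-entered `namespace Leaf` of §X.3 the
landed `…Theorems.PurityCut.Leaf` is opened so the g16
schema's short names resolve exactly as in the lens); file split only (tree files ≤ 400 lines): sections, variables,
the `open MvPolynomial` lines and every declaration exactly as in
the lens; the node's global dupNamespace-linter line dropped.  Node files, in import order: `CrossCutLaw` (§X.0 ring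
level; continued `…2`) · `CrossCutCells` (§X.2–§X.7
cone-free: the aside / port home; continued `…2`) · the wiring `MaxContactCutCrossCut` (§X BY NAME on the host
route, in the Theses cone).  All `--supports
stmt-ResolutionOfSingularities-29273` (`MaxContactCut.RungOne`); nothing closes 29273 — decided halves carry their
engines / ports as hypotheses (`CrossExit` is a paper engine);
exactly ONE located-residual aside on the lens-2 column (`Cross.CrossSpecialRung`) SUPERSEDES g19's
`Spread.SpreadSpecialRung`, re-located EXACTLY modulo the cross decided half,
and `ComponentPackagePort` is the column's ONE port item.

§X.2–§X.7 cone-free part: §X.2 point / curve level — `IsCrossAt` / `IsFlankAt` / `IsUniformCross`, the ENGINE `def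
CrossExit : Prop` (a paper engine: hypothesis), `IsCrossPt`, the decided class; §X.3 THE COMPONENT PORT —
`IsTopComponent` / `IsComponentExitPt` / **`ComponentPackagePort`** (PORT tag: the lens-2 column's ONE port item;
`curvePackagePort_of_componentPackagePort` derives the older `CurvePackagePort`) and the `Leaf` schema over the
port; §X.4 the leaf `crossLeaf = spreadLeaf ∨ (X)` and the located residual class `IsCrossSpecialPt`; §X.5–§X.7
`namespace Cross`: graded statements, the rungs **`CrossGenericRung`** (DECIDED half modulo ports) /
**`CrossSpecialRung`** (THE LOCATED RESIDUAL — the ONE aside on the lens-2 column, SUPERSEDING g19's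
`Spread.SpreadSpecialRung`), iffs and hypothesis-free links — this module chain is the cone-free aside/port home
(continued `…2` where the cap cuts).  The cut BY NAME on the route is in `MaxContactCutCrossCut`.

Part 1/2 carries: `IsCrossAt`, `IsFlankAt`, `IsUniformCross`, `CrossExit`, `IsCrossPt`, `eq_two_of_isCrossPt`,
`idealOrder_eq_of_isCrossPt`, `IsTopComponent`, `IsComponentExitPt`, `ComponentPackagePort`,
`curvePackagePort_of_componentPackagePort`, `isTopComponent_of_isUniformCross`, `isComponentExitPt_of_isCrossPt`,
`isComponentExitPt_of_isCurveExitPt`, `genRungAt_of_componentPort`, `genericRung_of_componentPort`, `crossLeaf`,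
`spreadLeaf_le_crossLeaf`, `cylLeaf_le_crossLeaf`, `splitLeaf_le_crossLeaf`, `grandLeaf_le_crossLeaf`,
`vastLeaf_le_crossLeaf`, `pinchLeaf_le_crossLeaf`, `crossLeaf_of_isCrossPt`, `IsCrossSpecialPt`.

(Sources: Hironaka1964 Ch. III; CossartJannsenSaito2020 Ch. 2, Ch. 8–9; CossartPiltant2008 Prop. 4.2;
CossartPiltant2019 Rem. 3.2; BierstoneGrigorievMilmanWlodarczyk2011 §3.1; Moh1987; Hauser2010Kangaroo; Giraud1975;
Narasimhan1983.)
-/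

open CategoryTheory AlgebraicGeometry TopologicalSpace IsLocalRing
open Literature.AlgebraicGeometry.Resolution
open Summit.ResolutionOfSingularities.ResolutionOfSingularities.Theorems
open Summit.ResolutionOfSingularities.ResolutionOfSingularities.Theorems.WeakOrderReduction
open Summit.ResolutionOfSingularities.ResolutionOfSingularities.Theorems.DeltaFaceCutClasses
open Summit.ResolutionOfSingularities.ResolutionOfSingularities.Theorems.RelativeDeltaCut
open Summit.ResolutionOfSingularities.ResolutionOfSingularities.Theorems.CurveLeafExit
open Summit.ResolutionOfSingularities.ResolutionOfSingularities.Theorems.PinchCut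
open Summit.ResolutionOfSingularities.ResolutionOfSingularities.Theorems.JetCut
open Summit.ResolutionOfSingularities.ResolutionOfSingularities.Theorems.PurityCut
open Summit.ResolutionOfSingularities.ResolutionOfSingularities.Theorems.SplitCut
open Summit.ResolutionOfSingularities.ResolutionOfSingularities.Theorems.CylinderCut
open Summit.ResolutionOfSingularities.ResolutionOfSingularities.Theorems.SpreadCut
open MvPolynomial

namespace Summit.ResolutionOfSingularities.ResolutionOfSingularities.Theorems.CrossCut

/-! ### §X.2  point / curve level — the cross letters (X) (F), the uniform class, ENGINE (X), the decided class -/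

/-- **CROSS-SHAPED at `y`, the tangle point of the branches `η₁` (steep) and `η₂` (flat)** [g20] (`IsCrossAt I q η₁
η₂ y`): a minimal system
`c = (z, u₁, u₂, v)` of `𝔪_y` (`spanFinrank = 4`) with `(z, u₁, u₂)` generating `curvePrime (η₁ ⤳ y)` and `(z, u₁,
v)` generating
`curvePrime (η₂ ⤳ y)` — BOTH BRANCHES REGULAR AT `y`, MEETING TRANSVERSALLY INSIDE THE REGULAR SURFACE `V(z, u₁)` —
and `I_y` of CROSS SHAPE in
this frame (`CrossShape (stalkIdeal I y) c q`).  DEFINITION (NEW class predicate). (Sources: Hironaka1967;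
CossartJannsenSaito2020 Ch. 8;
CossartPiltant2019 Def. 3.5.) -/
def IsCrossAt {Y : Scheme.{0}} (I : Y.IdealSheafData) (q : ℕ) (η₁ η₂ y : Y) : Prop :=
  ∃ (h₁ : η₁ ⤳ y) (h₂ : η₂ ⤳ y) (c : Fin 4 → Y.presheaf.stalk y),
    Ideal.span {c 0, c 1, c 2} = curvePrime h₁ ∧ Ideal.span {c 0, c 1, c 3} = curvePrime h₂ ∧
      Ideal.span (Set.range c) = maximalIdeal (Y.presheaf.stalk y) ∧
      (maximalIdeal (Y.presheaf.stalk y)).spanFinrank = 4 ∧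
      CrossShape (stalkIdeal I y) c q

/-- **FLANK-SHAPED at `y` along the flat branch `η₂`** [g20] (`IsFlankAt I q η₂ y`): a minimal system `c = (z, u₁,
v, t)` of `𝔪_y` with
`(z, u₁, v)` generating `curvePrime (η₂ ⤳ y)` (the branch regular at `y`, `t` inert) and `I_y` of FLANK SHAPE
(`FlankShape (stalkIdeal I y) 𝔪_y
(curvePrime h₂) c q`: deep pinch `z² + μv²` with `μ̄` a uniformiser of `𝒪_{C₂,y}`, transversal term `ε₁u₁^{2q+1}`).
DEFINITION (NEW class
predicate). (Sources: Hironaka1967; CossartJannsenSaito2020 Ch. 8; CossartPiltant2019 Def. 3.5.) -/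
def IsFlankAt {Y : Scheme.{0}} (I : Y.IdealSheafData) (q : ℕ) (η₂ y : Y) : Prop :=
  ∃ (h₂ : η₂ ⤳ y) (c : Fin 4 → Y.presheaf.stalk y),
    Ideal.span {c 0, c 1, c 2} = curvePrime h₂ ∧
      Ideal.span (Set.range c) = maximalIdeal (Y.presheaf.stalk y) ∧
      (maximalIdeal (Y.presheaf.stalk y)).spanFinrank = 4 ∧
      FlankShape (stalkIdeal I y) (maximalIdeal (Y.presheaf.stalk y)) (curvePrime h₂) c q

/-- **UNIFORM CROSS** [g20] (`IsUniformCross I n q η₁ η₂`) — THE UNIT OF ENGINE (X): marking `n = 2`, `q ≥ 1` (`m =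
2q + 1 ≥ 3`); two
DISTINCT curve points `η₁` (steep branch `C₁`) and `η₂` (flat branch `C₂`) whose closures MEET; the union `T = C₁ ∪
C₂` lies in the order-`n`
locus and is OPEN in it (some open `U ⊇ T` meets the order-`n` locus only inside `T`: `T` is a connected component
of the top locus — the
two-branch analogue of the tree's `IsTopIsolatedClosure`); and at every CLOSED point the letter of its position:
cross letter at the points
of `C₁ ∩ C₂`, g19's SPREAD letter `IsSpreadAt I 2 (2q+1) η₁` at the points of `C₁ ∖ C₂`, flank letter at the points
of `C₂ ∖ C₁`.  (Frames,
units, tails, pinch coefficients vary with the point; `q` is constant along `T`.)  DEFINITION (NEW class predicate). -/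
def IsUniformCross {Y : Scheme.{0}} (I : Y.IdealSheafData) (n q : ℕ) (η₁ η₂ : Y) : Prop :=
  n = 2 ∧ 1 ≤ q ∧ η₁ ≠ η₂ ∧ IsCurvePt η₁ ∧ IsCurvePt η₂ ∧ (∃ x : Y, η₁ ⤳ x ∧ η₂ ⤳ x) ∧
    (∀ x : Y, (η₁ ⤳ x ∨ η₂ ⤳ x) → idealOrder I x = ((n : ℕ) : ℕ∞)) ∧
    (∃ U : Y.Opens, (∀ x : Y, (η₁ ⤳ x ∨ η₂ ⤳ x) → x ∈ U) ∧
      ∀ x : Y, x ∈ U → idealOrder I x = ((n : ℕ) : ℕ∞) → (η₁ ⤳ x ∨ η₂ ⤳ x)) ∧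
    ∀ y : Y, IsClosed ({y} : Set Y) →
      (η₁ ⤳ y → η₂ ⤳ y → IsCrossAt I q η₁ η₂ y) ∧
      (η₁ ⤳ y → ¬ η₂ ⤳ y → IsSpreadAt I 2 (2 * q + 1) η₁ y) ∧
      (η₂ ⤳ y → ¬ η₁ ⤳ y → IsFlankAt I q η₂ y)

/-- **ENGINE (X) `CrossExit`** [g20; DECIDED · paper proof = module docstring §X.1 (ONE package of length `2q` with
INTRINSIC centres: the
spread tower `C₁, Σ₁, …, Σ_{q−1}` of g19 (`Σ_j = Top(I_j) ∩ π⁻¹C₁`), then the strict transform `C₂^(q)` of the flat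
branch and its section
tower `Σ′₁, …, Σ′_{q−1}` (`Σ′_j = Top ∩ E′_j` over `C₂^(q)`); bookkeeping by the two weights — g19's `e_j = |α| +
j(i − 2)` along `C₁` and the
flank weight `q·i + a + q·c`, invariant under the first tower, along `C₂`; EXIT: `τ = 3` at the last tangle point
(`in = Z′² + ε̄₁UW`),
order `≤ 1` / Eisenstein fibres in the side charts, order `1` at the end of every flank fibre (`ε₁u₁` linear), g19's
`τ ≥ 3` over the spread
points) · `n = 2` · every regular scheme of dimension four along `T` · port L only (blow-up charts, controlled
transform, semicontinuity of
order, `gr` of a regular local ring, properness of `ℙ¹_A`)]: on a regular scheme, a uniform cross has an exit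
package with centres over
`T = C₁ ∪ C₂`.  STATEMENT (engine). (Sources: Hironaka1967; CossartJannsenSaito2020 Ch. 2, Ch. 8; CossartPiltant2008 Prop. 4.2;
CossartPiltant2019 Def. 3.5; BierstoneGrigorievMilmanWlodarczyk2011 §3; StacksProject Tag 0805.) -/
def CrossExit : Prop :=
  ∀ (Y : Scheme.{0}), Scheme.IsRegular Y → ∀ (I : Y.IdealSheafData) (n q : ℕ) (η₁ η₂ : Y),
    IsUniformCross I n q η₁ η₂ → PackageExitsOver I n {x : Y | η₁ ⤳ x ∨ η₂ ⤳ x}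

/-- **CROSS point** [g20] (NEW DECIDED CLASS, leaf (X)): `y` lies on (or is a generic point of a branch of) a
uniform cross `T = C₁ ∪ C₂`.
Inhabitant: the TANGLE of INSEP-vv (NODE-g19 §7; NODE-g20 §3: the origin, cross letter with `q = 2`, certified
`crossShape_insepVV`) — and
every point of its two top curves.  NOT Top-isolated (two curves through `y`): new territory by letter for every
curve port of the tree.
DEFINITION (NEW class). -/
def IsCrossPt {Y : Scheme.{0}} (I : Y.IdealSheafData) (n : ℕ) (y : Y) : Prop :=
  ∃ (q : ℕ) (η₁ η₂ : Y), (η₁ ⤳ y ∨ η₂ ⤳ y) ∧ IsUniformCross I n q η₁ η₂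

/-- The cross class lives at marking `2` only (all bed inhabitants are characteristic-`2` double points; for `n ≥ 3`
the two towers leave an
isolated point `P_n = zⁿ + u^{n−1}(ε₂Vⁿ + ε₁W^{n−1})` of `τ = 1`, booked).  KERNEL (PROVED; letter bookkeeping). [folklore] -/
theorem eq_two_of_isCrossPt {Y : Scheme.{0}} {I : Y.IdealSheafData} {n : ℕ} {y : Y} (h : IsCrossPt I n y) : n = 2 := by
  obtain ⟨_, _, _, _, hn, _⟩ := h
  exact hn

/-- A cross point is a top point.  KERNEL (PROVED). [folklore] -/
theorem idealOrder_eq_of_isCrossPt {Y : Scheme.{0}} {I : Y.IdealSheafData} {n : ℕ} {y : Y} (h : IsCrossPt I n y) :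
    idealOrder I y = ((n : ℕ) : ℕ∞) := by
  obtain ⟨_, _, _, hy, _, _, _, _, _, _, hT, _, _⟩ := h
  exact hT _ hy

/-! ### §X.3  THE COMPONENT PORT (engine-free bookkeeping, COSTUME(M+)) and the leaf schema over it -/

/-- **TOP COMPONENT** [g20] (`IsTopComponent I n T`): `T` lies in the order-`n` locus, is CLOSED and preconnected,
and some open `U ⊇ T` meets
the order-`n` locus only inside `T` — in the frame `ord ≤ n`, `T` is a CONNECTED COMPONENT of the (noetherian) top
locus, open and closed in it;
two units of this kind are disjoint or equal, and a unit is disjoint from every Top-isolated closure / isolated top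
point it does not
contain.  The many-branch analogue of the tree's `IsTopIsolatedClosure`; needed by the PORT only.  DEFINITION (NEW
class predicate).
 -/
def IsTopComponent {Y : Scheme.{0}} (I : Y.IdealSheafData) (n : ℕ) (T : Set Y) : Prop :=
  (∀ x : Y, x ∈ T → idealOrder I x = ((n : ℕ) : ℕ∞)) ∧ IsClosed T ∧ _root_.IsPreconnected T ∧
    ∃ U : Y.Opens, T ⊆ (U : Set Y) ∧ ∀ x : Y, x ∈ U → idealOrder I x = ((n : ℕ) : ℕ∞) → x ∈ T

/-- **COMPONENT-EXIT point** [g20] (`IsComponentExitPt I n y`): `y` lies on a top component `T` carrying an exit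
package with centres over
`T`.  DEFINITION (NEW class; hypothesis shape of the component port). -/
def IsComponentExitPt {Y : Scheme.{0}} (I : Y.IdealSheafData) (n : ℕ) (y : Y) : Prop :=
  ∃ T : Set Y, y ∈ T ∧ IsTopComponent I n T ∧ PackageExitsOver I n T

/-- **`ComponentPackagePort n`** [g20; COSTUME(M+) · engine-free bookkeeping = the tree's `CurvePackagePort` (g12)
with COMPONENT UNITS;
proof (module docstring §X.1 (port)): the units — isolated closed exit points, Top-isolated curves with packages,
top components with
packages — are pairwise disjoint OPEN-AND-CLOSED subsets of the noetherian top locus, hence finitely many; process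
them one at a time: run
the unit's package (its centres lie over the unit, so off the unit the datum is untouched up to the isomorphism),
after which every point
over the unit has order `< n` or `τ ≥ 2` (class ≥ 2); transport the remaining units by the isomorphism; finally
apply `SeqDimFour 2 n` to
the transformed datum (all of whose top points are now of class ≥ 2) and concatenate]: if every top point of a dim-4
datum is of class ≥ 2,
a near-exit point (g10), a package-exit point (g11), a curve-exit point (g12) or a COMPONENT-exit point, then
`SeqDimFour 2 n` already
yields a weak resolution.  STATEMENT (port). (Sources: BierstoneGrigorievMilmanWlodarczyk2011 Def. 3.1.3;
CossartPiltant2008 Prop. 4.2;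
CossartJannsenSaito2020 Ch. 2.) -/
def ComponentPackagePort (n : ℕ) : Prop :=
  SeqDimFour 2 n →
  ∀ p : ℕ, p.Prime → ∀ (k : Type) [Field k] [CharP k p]
    (Y : Scheme.{0}) (g : Y ⟶ Spec (.of k)), IsSeparated g → LocallyOfFiniteType g → QuasiCompact g →
    ∀ hY : Scheme.IsRegular Y, topologicalKrullDim Y ≤ 4 →
    ∀ I : Y.IdealSheafData, (∀ y : Y, idealOrder I y ≤ ((n : ℕ) : ℕ∞)) →
      (∀ y : Y, idealOrder I y = ((n : ℕ) : ℕ∞) →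
        ClassGE g hY I n 2 y ∨ VeryNearCutClasses.IsNearExitPt I n y ∨ IsPackageExitPt I n y ∨
          IsCurveExitPt I n y ∨ IsComponentExitPt I n y) →
      ∃ t : CentreSeq Y, WeakResolution t (⟨I, [], n⟩ : MarkedIdeal Y)

/-- The component port CONTAINS g12's curve port by letter (one more kind of unit).  KERNEL (PROVED). [folklore] -/
theorem curvePackagePort_of_componentPackagePort {n : ℕ} (h : ComponentPackagePort n) : CurvePackagePort n := by
  intro h2 p hp k _ _ Y g hg1 hg2 hg3 hY h4 I hord hcls
  refine h h2 p hp k Y g hg1 hg2 hg3 hY h4 I hord ?_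
  intro y hy
  rcases hcls y hy with h | h | h | h
  · exact Or.inl h
  · exact Or.inr (Or.inl h)
  · exact Or.inr (Or.inr (Or.inl h))
  · exact Or.inr (Or.inr (Or.inr (Or.inl h)))

/-- **A UNIFORM CROSS IS A TOP COMPONENT** [g20; KERNEL (PROVED)]: `T = C₁ ∪ C₂ = closure {η₁} ∪ closure {η₂}` is
closed and preconnected
(two irreducible closed sets through a common point), lies in the order-`n` locus and is open in it (the clopen
clause of the class). [folklore] -/
theorem isTopComponent_of_isUniformCross {Y : Scheme.{0}} {I : Y.IdealSheafData} {n q : ℕ} {η₁ η₂ : Y}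
    (h : IsUniformCross I n q η₁ η₂) : IsTopComponent I n {x : Y | η₁ ⤳ x ∨ η₂ ⤳ x} := by
  obtain ⟨_, _, _, _, _, ⟨x₀, hx₁, hx₂⟩, hT, ⟨U, hTU, hUT⟩, _⟩ := h
  have e₁ : {x : Y | η₁ ⤳ x} = closure ({η₁} : Set Y) := Set.ext fun x => specializes_iff_mem_closure
  have e₂ : {x : Y | η₂ ⤳ x} = closure ({η₂} : Set Y) := Set.ext fun x => specializes_iff_mem_closure
  have hu : {x : Y | η₁ ⤳ x ∨ η₂ ⤳ x} = {x : Y | η₁ ⤳ x} ∪ {x : Y | η₂ ⤳ x} := by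
    ext x
    simp
  refine ⟨fun x hx => hT x hx, ?_, ?_, ⟨U, fun x hx => hTU x hx, fun x hx hox => hUT x hx hox⟩⟩
  · rw [hu, e₁, e₂]
    exact isClosed_closure.union isClosed_closure
  · have h₁ : _root_.IsPreconnected {x : Y | η₁ ⤳ x} := by
      rw [e₁]
      exact isPreconnected_singleton.closure
    have h₂ : _root_.IsPreconnected {x : Y | η₂ ⤳ x} := by
      rw [e₂]
      exact isPreconnected_singleton.closure
    rw [hu]
    exact IsPreconnected.union x₀ hx₁ hx₂ h₁ h₂

/-- **ENGINE (X) AT WORK, pointwise** [g20; KERNEL (PROVED)]: under `CrossExit`, every cross point of a regular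
scheme is a component-exit
point of the component port. [folklore] -/
theorem isComponentExitPt_of_isCrossPt {Y : Scheme.{0}} {I : Y.IdealSheafData} {n : ℕ} {y : Y}
    (hX : CrossExit) (hY : Scheme.IsRegular Y) (h : IsCrossPt I n y) : IsComponentExitPt I n y := by
  obtain ⟨q, η₁, η₂, hy, hU⟩ := h
  exact ⟨{x : Y | η₁ ⤳ x ∨ η₂ ⤳ x}, hy, isTopComponent_of_isUniformCross hU, hX Y hY I n q η₁ η₂ hU⟩

/-- A Top-isolated curve with a package is a top component with a package PROVIDED its closure lies in the order-`n`
locus (automatic in the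
frame `ord ≤ n` by semicontinuity; recorded with the hypothesis explicit).  KERNEL (PROVED). [folklore] -/
theorem isComponentExitPt_of_isCurveExitPt {Y : Scheme.{0}} {I : Y.IdealSheafData} {n : ℕ} {y : Y}
    (h : IsCurveExitPt I n y) (hTop : ∀ (η x : Y), η ⤳ y → η ⤳ x → idealOrder I η = ((n : ℕ) : ℕ∞) →
      idealOrder I x = ((n : ℕ) : ℕ∞)) : IsComponentExitPt I n y := by
  obtain ⟨η, hηy, _, ⟨hordη, U, hTU, hUT⟩, hP⟩ := h
  have e : {x : Y | η ⤳ x} = closure ({η} : Set Y) := Set.ext fun x => specializes_iff_mem_closure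
  refine ⟨{x : Y | η ⤳ x}, hηy, ⟨fun x hx => hTop η x hηy hx hordη, ?_, ?_,
    ⟨U, fun x hx => hTU x hx, fun x hx hox => hUT x hx hox⟩⟩, hP⟩
  · rw [e]
    exact isClosed_closure
  · rw [e]
    exact isPreconnected_singleton.closure

namespace Leaf

open Summit.ResolutionOfSingularities.ResolutionOfSingularities.Theorems.PurityCut.Leaf

variable {L : ∀ ⦃Y : Scheme.{0}⦄, Y.IdealSheafData → ℕ → Y → Prop}
variable {n : ℕ}

/-- **THE ENGINES AT WORK over the COMPONENT PORT (schema)** [g20]: the five tree engines, an «`L`-points are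
curve-exit OR component-exit
points» hypothesis for the leaf, and the component port give `GenRungAt L n` for `n ≥ 2`.  KERNEL (PROVED). [folklore] -/
theorem genRungAt_of_componentPort (hV : VeryNearCutClasses.VeryNearExit) (hD : DeltaPackageExit)
    (hU : UniformCurvePackageExit) (hR : RelCurvePackageExit) (hN : NormalConeJumpExit)
    (hL : ∀ ⦃Y : Scheme.{0}⦄, Scheme.IsRegular Y → ∀ ⦃I : Y.IdealSheafData⦄ ⦃y : Y⦄,
      L I n y → IsCurveExitPt I n y ∨ IsComponentExitPt I n y)
    (hP : ComponentPackagePort n) (hn : 2 ≤ n) : GenRungAt L n := by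
  intro h2 p hp k _ _ Y g hg1 hg2 hg3 hY h4 I hord hcls
  refine hP h2 p hp k Y g hg1 hg2 hg3 hY h4 I hord ?_
  intro y hy
  rcases hcls y hy with (h | h | h | h | h | h) | h
  · exact Or.inl h
  · exact Or.inr (Or.inl (isNearExitPt_of_isNearGenericPt hV hY hn h))
  · exact Or.inr (Or.inr (Or.inl (isPackageExitPt_of_isDeltaGenericPt hD hY hn hy h)))
  · exact Or.inr (Or.inr (Or.inr (Or.inl (isCurveExitPt_of_isCurveGenericPt hU hY hn h))))
  · exact Or.inr (Or.inr (Or.inr (Or.inl (isCurveExitPt_of_isRelCurveGenericPt hR hY hn h))))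
  · exact Or.inr (Or.inr (Or.inr (Or.inl (isCurveExitPt_of_isFlatCurvePt hN hY hn h))))
  · rcases hL hY h with h' | h'
    · exact Or.inr (Or.inr (Or.inr (Or.inl h')))
    · exact Or.inr (Or.inr (Or.inr (Or.inr h')))

/-- **`GenericRung L` is DECIDED modulo the typed pieces over the COMPONENT PORT** (schema) [g20].  KERNEL (PROVED).
[folklore] -/
theorem genericRung_of_componentPort (hV : VeryNearCutClasses.VeryNearExit) (hD : DeltaPackageExit)
    (hU : UniformCurvePackageExit) (hR : RelCurvePackageExit) (hN : NormalConeJumpExit)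
    (hL : ∀ n : ℕ, 2 ≤ n → ∀ ⦃Y : Scheme.{0}⦄, Scheme.IsRegular Y → ∀ ⦃I : Y.IdealSheafData⦄ ⦃y : Y⦄,
      L I n y → IsCurveExitPt I n y ∨ IsComponentExitPt I n y)
    (hP : ∀ n : ℕ, 2 ≤ n → ComponentPackagePort n) (h1 : FaceFormCutClasses.OrderOneContact) : GenericRung L := by
  intro hE2 n hn
  by_cases h : 2 ≤ n
  · exact genRungAt_of_componentPort hV hD hU hR hN (hL n h) (hP n h) h (hE2 n hn)
  · have hn1 : n = 1 := by omega
    subst hn1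
    exact genRungAt_one h1 (hE2 1 hn)

end Leaf

/-! ## §X.4  NEW (g20): the CROSS cut — the leaf `crossLeaf = spreadLeaf ∨ (X)`, its located residual class
`IsCrossSpecialPt`, the rungs
(instances of §G over the COMPONENT port), `Cross.closes` BY NAME, the engines at work, and the EXACT RE-LOCATION of g19's
`Spread.SpreadSpecialRung` (and of g18's `Cyl.CylSpecialRung`, g17's `Split.SplitSpecialRung`, g16's
`Grand.GrandSpecialRung`, g15's
`Vast.VastSpecialRung`, g14's `PinchSpecialRung`, the tree aside 33866 `MaxContactCut.LeafSpecialRung`) modulo the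
cross decided half — all
0 sorry. -/

/-- The CROSS leaf of g20: spread leaf (g19) ∨ cross point.  DEFINITION (leaf instance). [folklore] -/
def crossLeaf : ∀ ⦃Y : Scheme.{0}⦄, Y.IdealSheafData → ℕ → Y → Prop :=
  fun _ I n y => spreadLeaf I n y ∨ IsCrossPt I n y

/-- `spreadLeaf_le_crossLeaf`: Auxiliary step of this node's calculus, VERBATIM from the lens file (see the module
docstring); the statement is its type. [folklore] -/
theorem spreadLeaf_le_crossLeaf ⦃Y : Scheme.{0}⦄ (I : Y.IdealSheafData) (n : ℕ) (y : Y) :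
    spreadLeaf I n y → crossLeaf I n y :=
  fun h => Or.inl h

/-- `cylLeaf_le_crossLeaf`: Auxiliary step of this node's calculus, VERBATIM from the lens file (see the module
docstring); the statement is its type. [folklore] -/
theorem cylLeaf_le_crossLeaf ⦃Y : Scheme.{0}⦄ (I : Y.IdealSheafData) (n : ℕ) (y : Y) :
    cylLeaf I n y → crossLeaf I n y :=
  fun h => Or.inl (cylLeaf_le_spreadLeaf I n y h)

/-- `splitLeaf_le_crossLeaf`: Auxiliary step of this node's calculus, VERBATIM from the lens file (see the module
docstring); the statement is its type. [folklore] -/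
theorem splitLeaf_le_crossLeaf ⦃Y : Scheme.{0}⦄ (I : Y.IdealSheafData) (n : ℕ) (y : Y) :
    splitLeaf I n y → crossLeaf I n y :=
  fun h => Or.inl (splitLeaf_le_spreadLeaf I n y h)

/-- `grandLeaf_le_crossLeaf`: Auxiliary step of this node's calculus, VERBATIM from the lens file (see the module
docstring); the statement is its type. [folklore] -/
theorem grandLeaf_le_crossLeaf ⦃Y : Scheme.{0}⦄ (I : Y.IdealSheafData) (n : ℕ) (y : Y) :
    grandLeaf I n y → crossLeaf I n y :=
  fun h => Or.inl (grandLeaf_le_spreadLeaf I n y h)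

/-- `vastLeaf_le_crossLeaf`: Auxiliary step of this node's calculus, VERBATIM from the lens file (see the module
docstring); the statement is its type. [folklore] -/
theorem vastLeaf_le_crossLeaf ⦃Y : Scheme.{0}⦄ (I : Y.IdealSheafData) (n : ℕ) (y : Y) :
    vastLeaf I n y → crossLeaf I n y :=
  fun h => Or.inl (vastLeaf_le_spreadLeaf I n y h)

/-- `pinchLeaf_le_crossLeaf`: Auxiliary step of this node's calculus, VERBATIM from the lens file (see the module
docstring); the statement is its type. [folklore] -/
theorem pinchLeaf_le_crossLeaf ⦃Y : Scheme.{0}⦄ (I : Y.IdealSheafData) (n : ℕ) (y : Y) :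
    pinchLeaf I n y → crossLeaf I n y :=
  fun h => Or.inl (pinchLeaf_le_spreadLeaf I n y h)

/-- `crossLeaf_of_isCrossPt`: Auxiliary step of this node's calculus, VERBATIM from the lens file (see the module
docstring); the statement is its type. [folklore] -/
theorem crossLeaf_of_isCrossPt ⦃Y : Scheme.{0}⦄ {I : Y.IdealSheafData} {n : ℕ} {y : Y}
    (h : IsCrossPt I n y) : crossLeaf I n y :=
  Or.inr h

/-- **CROSS-SPECIAL point** [g20] — THE LOCATED RESIDUAL CLASS of this node: spread-special (g19) and NOT a cross
point — the side of the
structural dichotomy where the top component through the core is NOT a uniform cross (or the core is Top-isolated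
but outside every decided
letter).  What is LEFT (booked, NODE-g20 §7): CUSPIDAL secondary curves (INSEP-v³, certified g19), crosses at
marking `n ≥ 3` (the isolated
point `P_n` after both towers), crosses whose flat branch has inert depth `≠ m` or whose branches are tangent /
singular at the tangle point,
three or more branches, top surfaces through the core (the tree's 30458 line), the regimes `m ≢ −1 mod n`, mixed
faces, NON-PRINCIPAL `I_y`
beyond the deep letters (iii), Sing / Iso (iv).  DEFINITION (NEW class). [folklore] -/
def IsCrossSpecialPt {k : Type} [Field k] {Y : Scheme.{0}} (g : Y ⟶ Spec (.of k)) (hY : Scheme.IsRegular Y)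
    (I : Y.IdealSheafData) (n : ℕ) (y : Y) : Prop :=
  IsSpreadSpecialPt g hY I n y ∧ ¬ IsCrossPt I n y

end Summit.ResolutionOfSingularities.ResolutionOfSingularities.Theorems.CrossCut
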